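import Mathlib.Analysis.SpecialFunctions.Trigonometric.Deriv
import Mathlib.Analysis.InnerProductSpace.Calculus
import Literature.Analysis.FluidPDE.AxisymmetricEuler
import Literature.Analysis.FluidPDE.WholeSpaceIBP
import HarnessLib

/-!
# The swirl equation of axisymmetric flows: discharge of `Fluid.swirl_transport`

Second sibling proof file of `AxisymmetricEuler.lean` (D-0014: named facts `def X : Prop` are
discharged as `theorem X_holds : X`; the first sibling, `AxisymmetricEulerProofs.lean`, holds
`IsClassicalNSSolutionOn.isAxisymmetric_of_data_holds`). It proves
`Literature.Analysis.FluidPDE.swirl_transport_holds`: for a classical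
Navier–Stokes (or, `ν = 0`, Euler) solution on `ℝ³ × S` with axisymmetric velocity and pressure,
the swirl `Γ = r u_θ = x₀u₁ − x₁u₀` satisfies, off the axis,
`∂ₜΓ + (u·∇)Γ = ν (ΔΓ − (2/r) ∂ᵣΓ) + (x₀f₁ − x₁f₀)`
(Koch–Nadirashvili–Seregin–Šverák 2009, eq. (1.8); Majda–Bertozzi §2.3.3, (2.58)–(2.59); for
`ν = 0` this is the first equation `∂ₜ(ru^θ) + u^r (ru^θ)_r + u^z (ru^θ)_z = 0` of the
axisymmetric Euler system in the `(u^θ, ω^θ, φ̃)` variables of Chen–Hou, Part I, (6.1), p. 53).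

## Proof

Write `Γ(y) = ⟪J y, u(y)⟫` with the infinitesimal rotation `J v = (−v₁, v₀, 0) = (d/dθ) R_θ v |₀`
(`Fluid.rotGen`; off the axis `J x = r e_θ`). Pair the momentum equation at `x` with `J x`:

* `⟪Jx, ∂ₜu⟫ = ∂ₜΓ` and `⟪Jx, f⟫ = x₀f₁ − x₁f₀` (linearity);
* `⟪Jx, (u·∇)u⟫ = (u·∇)Γ`, because `DΓ(x)h = ⟪Jx, Du(x)h⟫ + ⟪Jh, u(x)⟫` and `⟪Jv, v⟫ = 0`;
* `⟪Jx, ∇p⟫ = Dp(x)[Jx] = (d/dθ) p(R_θ x)|₀ = 0` by axisymmetry of `p`;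
* `⟪Jx, Δu⟫ = ΔΓ − 2(∂₀u₁ − ∂₁u₀)` (Leibniz rule, `ΔJ = 0`, `Σᵢ ⟪J eᵢ, ∂ᵢu⟫ = ∂₀u₁ − ∂₁u₀`), and
  `∂₀u₁ − ∂₁u₀ = (1/r) ∂ᵣΓ` for axisymmetric `u`, using the infinitesimal form
  `Du(x)[Jx] = J u(x)` of `u(R_θ x) = R_θ u(x)` (differentiate in `θ` at `0`).

All statements are folklore calculus; the cited equation is KNSS 2009, (1.8).
Used from Mathlib: `Real.hasDerivAt_cos`, `Real.hasDerivAt_sin`, `HasDerivAt.unique`,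
`fderiv_inner_apply`, `InnerProductSpace.laplacian_eq_iteratedFDeriv_orthonormalBasis` (through
the tree's `Fluid.laplacian_eq_sum_fderiv_fderiv`), `EuclideanSpace.basisFun`,
`InnerProductSpace.toDual_symm_apply`, `derivWithin_zero_of_not_uniqueDiffWithinAt`.
-/

noncomputable section

open Set Function Filter Topology WithLp
open scoped Laplacian InnerProductSpace RealInnerProductSpace ContDiff

namespace Literature.Analysis.FluidPDE

/-- Local notation for physical space `ℝ³ = EuclideanSpace ℝ (Fin 3)`. -/
local notation "ℝ³" => EuclideanSpace ℝ (Fin 3)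

/-! ### The infinitesimal rotation about the axis -/

/-- The infinitesimal generator of the rotations about the `x 2`-axis,
`J v = (−v₁, v₀, 0) = (d/dθ) R_θ v |_{θ=0}` (`hasDerivAt_rotZ_zero`); off the axis `J x = r e_θ`
(`rotGen_eq_cylRadius_smul_eTheta`), and `⟪J x, u x⟫ = x₀u₁ − x₁u₀` is the swirl
(`swirl_eq_inner_rotGen`) (KNSS 2009, §1: `Γ = r u_θ`, `e_θ = (−x₂, x₁, 0)/r`). [cite: KNSS2009, §1 (1.5) and (1.8)] -/
def rotGen (v : ℝ³) : ℝ³ :=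
  toLp 2 ![-v 1, v 0, 0]

/-- First component of the generator: `(J v)₀ = −v₁`. [folklore] -/
@[simp] theorem rotGen_apply_zero (v : ℝ³) : rotGen v 0 = -v 1 := rfl

/-- Second component of the generator: `(J v)₁ = v₀`. [folklore] -/
@[simp] theorem rotGen_apply_one (v : ℝ³) : rotGen v 1 = v 0 := rfl

/-- Third component of the generator: `(J v)₂ = 0`. [folklore] -/
@[simp] theorem rotGen_apply_two (v : ℝ³) : rotGen v 2 = 0 := rfl

/-- The generator as a continuous linear map. [folklore] -/
def rotGenL : ℝ³ →L[ℝ] ℝ³ :=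
  LinearMap.toContinuousLinearMap
    { toFun := rotGen
      map_add' := fun v w => by ext i; fin_cases i <;> (simp [rotGen]; try ring)
      map_smul' := fun c v => by ext i; fin_cases i <;> simp [rotGen] }

/-- The continuous linear map `rotGenL` is `rotGen`. [folklore] -/
@[simp] theorem rotGenL_apply (v : ℝ³) : rotGenL v = rotGen v := rfl

/-- `rotGen` is additive. [folklore] -/
theorem rotGen_add (v w : ℝ³) : rotGen (v + w) = rotGen v + rotGen w :=
  map_add rotGenL v w

/-- `rotGen` is homogeneous. [folklore] -/
theorem rotGen_smul (c : ℝ) (v : ℝ³) : rotGen (c • v) = c • rotGen v :=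
  map_smul rotGenL c v

/-- `rotGen` has derivative `rotGenL` everywhere (it is linear). [folklore] -/
theorem hasFDerivAt_rotGen (x : ℝ³) : HasFDerivAt rotGen rotGenL x :=
  rotGenL.hasFDerivAt

/-- `⟪J x, v⟫ = x₀ v₁ − x₁ v₀`. [folklore] -/
theorem inner_rotGen_left (x v : ℝ³) : ⟪rotGen x, v⟫ = x 0 * v 1 - x 1 * v 0 := by
  simp only [rotGen, PiLp.inner_apply, Fin.sum_univ_three, RCLike.inner_apply, conj_trivial,
    Matrix.cons_val_zero, Matrix.cons_val_one, Matrix.cons_val_two, Matrix.head_cons,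
    Matrix.tail_cons]
  ring

/-- `⟪J v, v⟫ = 0`: the generator is skew. [folklore] -/
theorem inner_rotGen_self (v : ℝ³) : ⟪rotGen v, v⟫ = 0 := by
  rw [inner_rotGen_left]; ring

/-- The generator on the standard basis: `J e₀ = e₁`. [folklore] -/
theorem rotGen_single_zero : rotGen (EuclideanSpace.single 0 1) = EuclideanSpace.single 1 1 := by
  ext i; fin_cases i <;> simp [rotGen]

/-- The generator on the standard basis: `J e₁ = −e₀`. [folklore] -/
theorem rotGen_single_one : rotGen (EuclideanSpace.single 1 1) = -EuclideanSpace.single 0 1 := by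
  ext i; fin_cases i <;> simp [rotGen]

/-- The generator on the standard basis: `J e₂ = 0`. [folklore] -/
theorem rotGen_single_two : rotGen (EuclideanSpace.single 2 1) = (0 : ℝ³) := by
  ext i; fin_cases i <;> simp [rotGen]

/-- `J x = x₀ e₁ − x₁ e₀` in the standard basis. [folklore] -/
theorem rotGen_eq_sub_single (x : ℝ³) :
    rotGen x = x 0 • EuclideanSpace.single 1 (1 : ℝ) - x 1 • EuclideanSpace.single 0 (1 : ℝ) := by
  ext i; fin_cases i <;> simp [rotGen]

/-- The horizontal position vector `(x₀, x₁, 0) = x₀ e₀ + x₁ e₁`. [folklore] -/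
theorem toLp_horizontal_eq_add_single (x : ℝ³) :
    (toLp 2 ![x 0, x 1, 0] : ℝ³) =
      x 0 • EuclideanSpace.single 0 (1 : ℝ) + x 1 • EuclideanSpace.single 1 (1 : ℝ) := by
  ext i; fin_cases i <;> simp

/-- Off the axis the generator is `r e_θ`: `J x = r • eTheta x`. [folklore] -/
theorem rotGen_eq_cylRadius_smul_eTheta {x : ℝ³} (hx : cylRadius x ≠ 0) :
    rotGen x = cylRadius x • eTheta x := by
  rw [eTheta, smul_smul, mul_inv_cancel₀ hx, one_smul]
  rfl

/-- The swirl is the pairing with the generator: `Γ(y) = ⟪J y, u y⟫`. [folklore] -/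
theorem swirl_eq_inner_rotGen (u : ℝ³ → ℝ³) : swirl u = fun y => ⟪rotGen y, u y⟫ := by
  funext y
  rw [inner_rotGen_left, swirl]

/-! ### Rotations: derivative at the identity, infinitesimal axisymmetry -/

/-- `R_θ x = cos θ (x₀, x₁, 0) + sin θ J x + (0, 0, x₂)`. [folklore] -/
theorem rotZ_eq_cos_sin (θ : ℝ) (x : ℝ³) :
    rotZ θ x = Real.cos θ • (toLp 2 ![x 0, x 1, 0] : ℝ³) + Real.sin θ • rotGen x +
      (toLp 2 ![0, 0, x 2] : ℝ³) := by
  ext i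
  fin_cases i <;> simp [rotGen] <;> ring

/-- The curve `θ ↦ R_θ x` has velocity `−sin θ (x₀, x₁, 0) + cos θ J x`. [folklore] -/
theorem hasDerivAt_rotZ (x : ℝ³) (θ₀ : ℝ) :
    HasDerivAt (fun θ => rotZ θ x)
      (-Real.sin θ₀ • (toLp 2 ![x 0, x 1, 0] : ℝ³) + Real.cos θ₀ • rotGen x) θ₀ := by
  have h : (fun θ => rotZ θ x) = fun θ =>
      Real.cos θ • (toLp 2 ![x 0, x 1, 0] : ℝ³) + Real.sin θ • rotGen x +
        (toLp 2 ![0, 0, x 2] : ℝ³) :=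
    funext fun θ => rotZ_eq_cos_sin θ x
  rw [h]
  exact (((Real.hasDerivAt_cos θ₀).smul_const (toLp 2 ![x 0, x 1, 0] : ℝ³)).add
    ((Real.hasDerivAt_sin θ₀).smul_const (rotGen x))).add_const (toLp 2 ![0, 0, x 2] : ℝ³)

/-- At `θ = 0` the velocity of `θ ↦ R_θ x` is the generator `J x`. [folklore] -/
theorem hasDerivAt_rotZ_zero (x : ℝ³) : HasDerivAt (fun θ => rotZ θ x) (rotGen x) 0 := by
  simpa using hasDerivAt_rotZ x 0

/-- **Infinitesimal axisymmetry of a vector field**: differentiating `u (R_θ x) = R_θ (u x)` at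
`θ = 0` gives `Du(x)[J x] = J (u x)` (KNSS 2009, §1: the components `u_r, u_θ, u_z` do not depend
on the angle). [folklore] -/
theorem IsAxisymmetric.fderiv_rotGen {u : ℝ³ → ℝ³} (hu : IsAxisymmetric u) {x : ℝ³}
    (hd : DifferentiableAt ℝ u x) : fderiv ℝ u x (rotGen x) = rotGen (u x) := by
  have h1 : HasDerivAt (fun θ => u (rotZ θ x)) (fderiv ℝ u x (rotGen x)) 0 := by
    have hu' : HasFDerivAt u (fderiv ℝ u x) (rotZ 0 x) := by
      rw [rotZ_zero]; exact hd.hasFDerivAt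
    exact hu'.comp_hasDerivAt (0 : ℝ) (hasDerivAt_rotZ_zero x)
  have heq : (fun θ => u (rotZ θ x)) = fun θ => rotZ θ (u x) := funext fun θ => hu θ x
  rw [heq] at h1
  exact h1.unique (hasDerivAt_rotZ_zero (u x))

/-- **Infinitesimal axisymmetry of a scalar field**: differentiating `p (R_θ x) = p x` at `θ = 0`
gives `Dp(x)[J x] = 0`, i.e. `∂_θ p = 0`. [folklore] -/
theorem IsAxisymmetricScalar.fderiv_rotGen {p : ℝ³ → ℝ} (hp : IsAxisymmetricScalar p) {x : ℝ³}
    (hd : DifferentiableAt ℝ p x) : fderiv ℝ p x (rotGen x) = 0 := by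
  have h1 : HasDerivAt (fun θ => p (rotZ θ x)) (fderiv ℝ p x (rotGen x)) 0 := by
    have hp' : HasFDerivAt p (fderiv ℝ p x) (rotZ 0 x) := by
      rw [rotZ_zero]; exact hd.hasFDerivAt
    exact hp'.comp_hasDerivAt (0 : ℝ) (hasDerivAt_rotZ_zero x)
  have heq : (fun θ => p (rotZ θ x)) = fun _ => p x := funext fun θ => hp θ x
  rw [heq] at h1
  exact h1.unique (hasDerivAt_const (0 : ℝ) (p x))

/-- For an axisymmetric scalar the gradient is orthogonal to the generator:
`⟪J x, ∇p(x)⟫ = x₀∂₁p − x₁∂₀p = 0`. [folklore] -/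
theorem IsAxisymmetricScalar.inner_rotGen_gradient {p : ℝ³ → ℝ} (hp : IsAxisymmetricScalar p)
    {x : ℝ³} (hd : DifferentiableAt ℝ p x) : ⟪rotGen x, gradient p x⟫ = 0 := by
  rw [real_inner_comm, gradient, InnerProductSpace.toDual_symm_apply]
  exact hp.fderiv_rotGen hd

/-! ### Derivatives of the swirl -/

/-- **First derivative of the swirl**: `DΓ(x)h = ⟪J x, Du(x)h⟫ + ⟪J h, u(x)⟫`. [folklore] -/
theorem fderiv_swirl_apply {u : ℝ³ → ℝ³} {x : ℝ³} (hd : DifferentiableAt ℝ u x) (h : ℝ³) :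
    fderiv ℝ (swirl u) x h = ⟪rotGen x, fderiv ℝ u x h⟫ + ⟪rotGen h, u x⟫ := by
  rw [swirl_eq_inner_rotGen, fderiv_inner_apply ℝ (hasFDerivAt_rotGen x).differentiableAt hd,
    (hasFDerivAt_rotGen x).fderiv, rotGenL_apply]

/-- The swirl of a differentiable field is differentiable. [folklore] -/
theorem differentiableAt_swirl {u : ℝ³ → ℝ³} {x : ℝ³} (hd : DifferentiableAt ℝ u x) :
    DifferentiableAt ℝ (swirl u) x := by
  rw [swirl_eq_inner_rotGen]
  exact ((hasFDerivAt_rotGen x).differentiableAt).inner ℝ hd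

/-- The swirl of a `Cⁿ` field is `Cⁿ`. [folklore] -/
theorem contDiff_swirl {u : ℝ³ → ℝ³} {n : WithTop ℕ∞} (hu : ContDiff ℝ n u) :
    ContDiff ℝ n (swirl u) := by
  rw [swirl_eq_inner_rotGen]
  exact rotGenL.contDiff.inner ℝ hu

/-- **Convective derivative of the swirl**: `(u·∇)Γ = ⟪J x, (u·∇)u⟫` (the term `⟪J u, u⟫`
vanishes). [folklore] -/
theorem convect_swirl {u : ℝ³ → ℝ³} {x : ℝ³} (hd : DifferentiableAt ℝ u x) :
    convect u (swirl u) x = ⟪rotGen x, convect u u x⟫ := by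
  rw [convect_apply, convect_apply, fderiv_swirl_apply hd, inner_rotGen_self, add_zero]

/-- **Horizontal derivative of the swirl of an axisymmetric field**: along the horizontal
position vector `(x₀, x₁, 0) = r e_r`, `DΓ(x)[(x₀, x₁, 0)] = r² (∂₀u₁ − ∂₁u₀)`, where
`∂ⱼuᵢ = (Du(x) eⱼ)ᵢ` (from `DΓ(x)h = ⟪Jx, Du h⟫ + ⟪Jh, u⟫` and the infinitesimal axisymmetry
`Du(x)[Jx] = J u(x)`). [folklore] -/
theorem IsAxisymmetric.fderiv_swirl_horizontal {u : ℝ³ → ℝ³} (hu : IsAxisymmetric u) {x : ℝ³}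
    (hd : DifferentiableAt ℝ u x) :
    fderiv ℝ (swirl u) x (toLp 2 ![x 0, x 1, 0]) = cylRadius x ^ 2 *
      (fderiv ℝ u x (EuclideanSpace.single 0 1) 1 - fderiv ℝ u x (EuclideanSpace.single 1 1) 0) := by
  -- the infinitesimal axisymmetry relations
  have hJ := hu.fderiv_rotGen hd
  rw [rotGen_eq_sub_single, map_sub, map_smul, map_smul] at hJ
  have hA := congrArg (fun v : ℝ³ => v 0) hJ
  have hB := congrArg (fun v : ℝ³ => v 1) hJ
  simp only [PiLp.sub_apply, PiLp.smul_apply, smul_eq_mul, rotGen_apply_zero,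
    rotGen_apply_one] at hA hB
  -- expand the horizontal derivative
  rw [fderiv_swirl_apply hd, toLp_horizontal_eq_add_single, map_add, map_smul, map_smul,
    rotGen_add, rotGen_smul, rotGen_smul, rotGen_single_zero, rotGen_single_one,
    inner_rotGen_left, cylRadius_sq]
  simp only [PiLp.add_apply, PiLp.smul_apply, smul_eq_mul, inner_add_left, inner_smul_left,
    inner_neg_left, EuclideanSpace.inner_single_left, map_one, one_mul, RCLike.conj_to_real]
  linear_combination x 0 * hA + x 1 * hB

/-- **Radial derivative of the swirl of an axisymmetric field**:
`∂ᵣΓ = r (∂₀u₁ − ∂₁u₀)`, where `∂ᵣ` is the derivative along `eR x` and `∂ⱼuᵢ = (Du(x) eⱼ)ᵢ`;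
equivalently `∂₀u₁ − ∂₁u₀ = (1/r)∂ᵣΓ` off the axis (the identity behind
`x₀Δu₁ − x₁Δu₀ = ΔΓ − (2/r)∂ᵣΓ`, Majda–Bertozzi §2.3.3). On the axis both sides vanish (junk
`eR = 0`). [folklore] -/
theorem IsAxisymmetric.partialDeriv_eR_swirl {u : ℝ³ → ℝ³} (hu : IsAxisymmetric u) {x : ℝ³}
    (hd : DifferentiableAt ℝ u x) :
    partialDeriv (eR x) (swirl u) x = cylRadius x *
      (fderiv ℝ u x (EuclideanSpace.single 0 1) 1 - fderiv ℝ u x (EuclideanSpace.single 1 1) 0) := by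
  rw [partialDeriv_apply, eR, map_smul, hu.fderiv_swirl_horizontal hd, smul_eq_mul]
  by_cases hx : cylRadius x = 0
  · simp [hx]
  · rw [← mul_assoc, pow_two, ← mul_assoc, inv_mul_cancel₀ hx, one_mul]

/-- **Laplacian of the swirl**: `ΔΓ = ⟪J x, Δu⟫ + 2(∂₀u₁ − ∂₁u₀)` for `C²` fields (Leibniz rule
for `Γ = ⟪J ·, u⟫`, `J` linear). [folklore] -/
theorem laplacian_swirl {u : ℝ³ → ℝ³} (hu : ContDiff ℝ 2 u) (x : ℝ³) :
    (Δ (swirl u)) x = ⟪rotGen x, (Δ u) x⟫ +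
      2 * (fderiv ℝ u x (EuclideanSpace.single 0 1) 1 - fderiv ℝ u x (EuclideanSpace.single 1 1) 0) := by
  classical
  set b := EuclideanSpace.basisFun (Fin 3) ℝ with hb
  have hb' : ∀ i, b i = EuclideanSpace.single i 1 := fun i => by
    simp [hb]
  have hu1 : Differentiable ℝ u := (hu.of_le one_le_two).differentiable one_ne_zero
  have hDi : ∀ e : ℝ³, Differentiable ℝ fun y => fderiv ℝ u y e := fun e =>
    ((hu.fderiv_right (m := 1) le_rfl).clm_apply contDiff_const).differentiable one_ne_zero
  -- first derivatives of the swirl along a fixed vector, as a function of the base point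
  have h1 : ∀ e : ℝ³, (fun y => fderiv ℝ (swirl u) y e) =
      fun y => ⟪rotGen y, fderiv ℝ u y e⟫ + ⟪rotGen e, u y⟫ := fun e =>
    funext fun y => fderiv_swirl_apply (hu1 y) e
  -- second derivatives
  have h2 : ∀ e : ℝ³, fderiv ℝ (fun y => fderiv ℝ (swirl u) y e) x e =
      ⟪rotGen x, fderiv ℝ (fun y => fderiv ℝ u y e) x e⟫ + 2 * ⟪rotGen e, fderiv ℝ u x e⟫ := by
    intro e
    rw [h1 e]
    rw [fderiv_fun_add (((hasFDerivAt_rotGen x).differentiableAt).inner ℝ (hDi e x))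
        ((differentiableAt_const _).inner ℝ (hu1 x))]
    rw [_root_.add_apply,
      fderiv_inner_apply ℝ (hasFDerivAt_rotGen x).differentiableAt (hDi e x),
      fderiv_inner_apply ℝ (differentiableAt_const _) (hu1 x), (hasFDerivAt_rotGen x).fderiv,
      fderiv_const_apply]
    simp only [rotGenL_apply, _root_.zero_apply, inner_zero_left, add_zero]
    ring
  rw [laplacian_eq_sum_fderiv_fderiv b (contDiff_swirl hu) x,
    laplacian_eq_sum_fderiv_fderiv b hu x]
  simp only [h2, Finset.sum_add_distrib, ← inner_sum, Fin.sum_univ_three, hb',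
    rotGen_single_zero, rotGen_single_one, rotGen_single_two, inner_neg_left, inner_zero_left,
    EuclideanSpace.inner_single_left, map_one, one_mul]
  ring

/-! ### Time derivative of the swirl -/

section TimeDeriv

variable {F G : Type*} [NormedAddCommGroup F] [NormedSpace ℝ F] [NormedAddCommGroup G]
  [NormedSpace ℝ G]

/-- A continuous linear map commutes with the one-sided derivative of a curve differentiable
within the set (both sides vanish where the derivative within the set is not unique). [folklore] -/
theorem derivWithin_clm_comp_apply (ℓ : F →L[ℝ] G) {g : ℝ → F} {S : Set ℝ} {t : ℝ}
    (hg : DifferentiableWithinAt ℝ g S t) :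
    derivWithin (fun s => ℓ (g s)) S t = ℓ (derivWithin g S t) := by
  by_cases hU : UniqueDiffWithinAt ℝ S t
  · exact (ℓ.hasFDerivAt.comp_hasDerivWithinAt t hg.hasDerivWithinAt).derivWithin hU
  · simp [derivWithin_zero_of_not_uniqueDiffWithinAt hU]

end TimeDeriv

/-- **Time derivative of the swirl**: `∂ₜΓ = ⟪J x, ∂ₜu⟫` for the one-sided time derivative
within `S` of a jointly smooth velocity. [folklore] -/
theorem timeDerivWithin_swirl {S : Set ℝ} {u : ℝ → ℝ³ → ℝ³} (h : IsSmoothSpaceTimeOn S u)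
    {t : ℝ} (ht : t ∈ S) (x : ℝ³) :
    timeDerivWithin S (fun s => swirl (u s)) t x = ⟪rotGen x, timeDerivWithin S u t x⟫ := by
  simp only [timeDerivWithin_apply, swirl_eq_inner_rotGen]
  have := derivWithin_clm_comp_apply (innerSL ℝ (rotGen x)) (h.differentiableWithinAt_time ht x)
  simpa only [innerSL_apply_apply] using this

/-! ### The discharge -/

/-- **Discharge of `Fluid.swirl_transport`** (KNSS 2009, eq. (1.8); Majda–Bertozzi §2.3.3,
(2.58)–(2.59); Chen–Hou, Part I, (6.1) for `ν = 0`): for a classical Navier–Stokes solution on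
`ℝ³ × S` with axisymmetric velocity and pressure, off the axis,
`∂ₜΓ + (u·∇)Γ = ν (ΔΓ − (2/r) ∂ᵣΓ) + (x₀f₁ − x₁f₀)`. Proof: pair the momentum equation with the
generator `J x` (`timeDerivWithin_swirl`, `convect_swirl`, `laplacian_swirl`,
`IsAxisymmetric.partialDeriv_eR_swirl`, `IsAxisymmetricScalar.inner_rotGen_gradient`). [cite: KNSS2009, eq. (1.8)] -/
theorem swirl_transport_holds : swirl_transport := by
  intro S ν f u p h hu hp t ht x hx
  have hU2 : ContDiff ℝ 2 (u t) := (h.contDiff_velocity ht).of_le (by norm_cast)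
  have hUd : DifferentiableAt ℝ (u t) x :=
    (hU2.of_le one_le_two).differentiable one_ne_zero x
  have hPd : DifferentiableAt ℝ (p t) x :=
    (((h.contDiff_pressure ht).of_le (by norm_cast) : ContDiff ℝ 1 (p t)).differentiable
      one_ne_zero) x
  have hmom := congrArg (fun v : ℝ³ => ⟪rotGen x, v⟫) (h.momentum t ht x)
  simp only [inner_add_right, inner_sub_right, inner_smul_right] at hmom
  rw [timeDerivWithin_swirl h.smooth_velocity ht x, convect_swirl hUd, hmom,
    laplacian_swirl hU2 x, (hp t ht).inner_rotGen_gradient hPd,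
    (hu t ht).partialDeriv_eR_swirl hUd, swirl_eq_inner_rotGen (f t)]
  field_simp
  ring

end Literature.Analysis.FluidPDE
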